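import Literature.Analysis.FluidPDE.QuasiSelfSimilarMoveSP12Checks1
import Literature.Analysis.FluidPDE.QuasiSelfSimilarMoveSP12Checks2
import Literature.Analysis.FluidPDE.QuasiSelfSimilarMoveSP12Checks3
import Literature.Analysis.FluidPDE.QuasiSelfSimilarMoveSC
import HarnessLib

/-!
# Straight move, phase 12: assembled checks and the slot

Topic `Literature/Analysis/FluidPDE`. Emitted data / kernel certificates of the explicit straight generating
move (`S`) in the typed-chain model, under the contract of `PlanarGeneratorAssembly.lean`
(`acm_compatible_blocks_of_slots`). Generated by the author's emitter from the exact rational design;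
no named facts, every theorem is decided in the kernel or assembled from decided chunks. [folklore]

## References

* G. Alberti, G. Crippa, A. L. Mazzucato, *Exponential self-similar mixing by incompressible
  flows*, J. Amer. Math. Soc. 32 (2019), 445–490, §8 (arXiv:1605.02090).
-/

noncomputable section

namespace Literature.Analysis.FluidPDE.QuasiSelfSimilar.MoveS

open PlanarKinematics QuasiSelfSimilar

set_option maxHeartbeats 4000000 in
/-- Node count. [folklore] -/
theorem P12_K : P12.K = 133 := by decide +kernel

/-- Kernel check of element validity (all nodes). [folklore] -/
theorem P12_valid : ∀ k < 133, (P12.node k).e.validB = true :=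
  (forall_lt_of_chunk (forall_lt_of_chunk (forall_lt_of_chunk (forall_lt_of_chunk (forall_lt_zero fun k => (P12.node k).e.validB = true) P12_valid_c0) P12_valid_c1) P12_valid_c2) P12_valid_c3)

/-- Kernel check of positivity (all nodes). [folklore] -/
theorem P12_pos : ∀ k < 133, (decide (0 < (P12.node k).box.ρ) && decide (0 < (P12.node k).step.len)) = true :=
  (forall_lt_of_chunk (forall_lt_of_chunk (forall_lt_of_chunk (forall_lt_of_chunk (forall_lt_zero fun k => (decide (0 < (P12.node k).box.ρ) && decide (0 < (P12.node k).step.len)) = true) P12_pos_c0) P12_pos_c1) P12_pos_c2) P12_pos_c3)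

/-- Kernel check of the node geometry (orders, pieces, cover tags) (all nodes). [folklore] -/
theorem P12_geo : ∀ k < 133, P12.geomAtB k = true :=
  (forall_lt_of_chunk (forall_lt_of_chunk (forall_lt_of_chunk (forall_lt_of_chunk (forall_lt_zero fun k => P12.geomAtB k = true) P12_geo_c0) P12_geo_c1) P12_geo_c2) P12_geo_c3)

/-- Kernel check of box separation rows (all nodes). [folklore] -/
theorem P12_sep : ∀ k < 133, P12.sepRowB k = true :=
  (forall_lt_of_chunk (forall_lt_of_chunk (forall_lt_of_chunk (forall_lt_of_chunk (forall_lt_zero fun k => P12.sepRowB k = true) P12_sep_c0) P12_sep_c1) P12_sep_c2) P12_sep_c3)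

/-- Kernel check of junction agreement (all nodes). [folklore] -/
theorem P12_agr : ∀ k < 133, P12.agreeAtB k = true :=
  (forall_lt_of_chunk (forall_lt_of_chunk (forall_lt_of_chunk (forall_lt_of_chunk (forall_lt_zero fun k => P12.agreeAtB k = true) P12_agr_c0) P12_agr_c1) P12_agr_c2) P12_agr_c3)

/-- `elemsValidB` of phase 12. [folklore] -/
theorem P12_elemsValidB : P12.elemsValidB = true :=
  PhaseQ.elemsValidB_of_forall (by decide +kernel) (by rw [P12_K]; exact P12_valid)

/-- `allPosB` of phase 12. [folklore] -/
theorem P12_allPosB : P12.allPosB = true :=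
  PhaseQ.allPosB_of_forall (by rw [P12_K]; exact P12_pos)

/-- `geomB` of phase 12. [folklore] -/
theorem P12_geomB : P12.geomB = true :=
  PhaseQ.geomB_of_geomAtB P12_elemsValidB P12_allPosB (by rw [P12_K]; exact P12_geo)

/-- `boxSepB` of phase 12. [folklore] -/
theorem P12_boxSepB : P12.boxSepB = true :=
  PhaseQ.boxSepB_of_sepRowB (by rw [P12_K]; exact P12_sep)

/-- `agreeB` of phase 12. [folklore] -/
theorem P12_agreeB : P12.agreeB = true :=
  PhaseQ.agreeB_of_agreeAtB (by rw [P12_K]; exact P12_agr)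

set_option maxHeartbeats 4000000 in
/-- `gateOKB` of phase 12 on its slot. [folklore] -/
theorem P12_gateOKB : P12.gateOKB C_S stub12 (mkRat (4) 5) = true := by decide +kernel

/-- Slot 12 of the straight move. [folklore] -/
def slot12 : Slot := ⟨P12, (mkRat (4) 5), stub12, rc12, rc12'⟩
/-- Slot test of slot 12. [folklore] -/
theorem slot12_okB : slot12.okB C_S (genGate .S) (mkRat (3) 200) = true :=
  Slot.okB_intro (s := slot12) P12_geomB P12_boxSepB P12_agreeB P12_gateOKB rfl (by decide)

end Literature.Analysis.FluidPDE.QuasiSelfSimilar.MoveS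

end
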